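import Literature.Analysis.FunctionSpaces.SobolevTraceDensityHigherProofs
import HarnessLib

/-!
# Discharged fact: the Meyers–Serrin theorem `H = W` (`Literature.Analysis.FunctionSpaces.meyers_serrin`)

`Literature.Analysis.FunctionSpaces.SobolevTrace` states, as the named fact `Literature.Analysis.FunctionSpaces.meyers_serrin`,
the theorem of Meyers and Serrin: on an *arbitrary* open set `Ω` of a finite-dimensional real
inner product space and for `1 ≤ p < ∞`, every `f ∈ W^{k,p}(Ω; F)` is the `W^{k,p}(Ω)`-limit of
functions smooth on `Ω` (N. Meyers, J. Serrin, *H = W*, Proc. Nat. Acad. Sci. USA 51 (1964)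
1055–1056; R. A. Adams, *Sobolev Spaces* (1975), Theorem 3.16 "(Meyers and Serrin)", numbered
Theorem 3.17 in the second edition of Adams–Fournier (2003); Evans, *PDE*, §5.3.2, Theorem 2).
This file proves it:

* `Literature.meyers_serrin_holds : meyers_serrin`.

The proof formalised is the printed one of Adams (1975), Theorem 3.16, pp. 51–53 (which is
the original argument of Meyers–Serrin), on top of the `W^{k,p}` toolkit of the accepted
`SobolevTraceDensityProofs` / `SobolevTraceDensityHigherProofs` (namespace `Literature.SobolevApprox`,
imported, nothing restated: linearity and Leibniz rule for weak derivatives, the triangle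
inequality `eSobolevDomainNorm_add_le` / `_sum_le` and locality `eSobolevDomainNorm_congr` of
the Sobolev norm, and Adams's Lemma 3.15 for all orders — "`J_ε ∗ u → u` in `W^{m,p}(Ω')`" —
in the patch form `tendsto_eSobolevDomainNorm_smul_sub_normed_convolution`: for
`ζ ∈ C_c^∞(Ω)` the mollifications of `ζ f` converge to `ζ f` in `W^{k,p}(Ω)`), and of the
discharged facts `Literature.Analysis.FunctionSpaces.HasWeakFDerivOn.unique_holds`, `Literature.Analysis.FunctionSpaces.HasWeakFDerivOn.of_contDiff_holds`,
`Literature.Analysis.FunctionSpaces.HasWeakFDerivOn.mono_set_holds` of `SobolevDomain(Proofs)`. What this file adds is the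
part of Theorem 3.16 that is specific to *arbitrary* open sets: exhaustion, the locally finite
telescoping partition of unity, support control of the mollified patches, and the monotone
convergence step.

## Proof (Adams 1975, Theorem 3.16, as printed; here for every order `k`)

Let `f ∈ W^{k,p}(Ω)`, `δ > 0`, `δ = Σⱼ δⱼ` with `δⱼ > 0`.

* **Part A, complements on the Sobolev norm.** `eSobolevDomainNorm (k+1)` is `‖f‖_{L^p(Ω)}`
  plus an infimum over weak derivatives; since weak derivatives are a.e. unique
  (`unique_holds`) and the norm only sees a.e. classes (`eSobolevDomainNorm_congr_ae`), the
  infimum is attained at *every* weak derivative (`eSobolevDomainNorm_succ_eq`); and the norm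
  is monotone in the domain (`eSobolevDomainNorm_mono_set`). (The triangle inequality and
  locality on `Ω` are `SobolevApprox.eSobolevDomainNorm_add_le`, `_sum_le`, `_congr`.)
* **Part B, geometry.** Smooth cut-offs equal to `1` near a compact set (smooth Urysohn,
  Mathlib's `exists_contMDiffMap_zero_one_nhds_of_isClosed`); functions smooth on `Ω` have
  their classical derivative as weak derivative on `Ω` (`hasWeakFDerivOn_of_contDiffOn`, by
  cutting off and `of_contDiff_holds`); the exhaustion
  `Vₘ = B(0, m+1) ∩ {infEdist(·, Ωᶜ) > 1/(m+1)}` of `Ω` by relatively compact open sets with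
  `closure Vₘ ⊆ V_{m+1}` (Adams: "`Ω_k = {x ∈ Ω : |x| < k, dist(x, bdry Ω) > 1/k}`"); and the
  monotone convergence step "`‖u - φ‖_{m,p,Ω_k} < ε` for all `k`, hence
  `‖u - φ‖_{m,p,Ω} ≤ ε`" in the form `‖f - φ‖_{W^{k,p}(Ω)} ≤ supₘ ‖f - φ‖_{W^{k,p}(Vₘ)}` for
  `f ∈ W^{k,p}(Ω)`, `φ ∈ C^∞(Ω)` (`eSobolevDomainNorm_sub_le_iSup`, induction on `k` using
  Part A and monotone convergence of `∫⁻` over the increasing union).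
* **Part D, patches and assembly** (Adams, proof of Theorem 3.16). One patch: for
  `ζ ∈ C_c^∞(Ω)` whose closed `d`-neighbourhood of its support lies in `Ω` and `η > 0`, a term
  of the mollified sequence of
  `SobolevApprox.tendsto_eSobolevDomainNorm_smul_sub_normed_convolution` (Lemma 3.15; centred
  kernels of radii `≤ d/2`) is a smooth `ψ` with
  `‖ζ f - ψ‖_{W^{k,p}(Ω)} ≤ η` supported in the closed `d/2`-neighbourhood of `supp ζ`
  (`exists_smooth_patch_approx`, support by `support_normed_convolution_subset`). Assembly:
  with cut-offs `χₘ = 1` near `closure Vₘ`, `supp χₘ ⊆ V_{m+1}`, the telescoping family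
  `ζ₀ = χ₀`, `ζ_{m+1} = χ_{m+1} - χₘ` is a smooth partition of unity on `Ω`
  (`Σ_{j ≤ M} ζⱼ = χ_M`), locally finite: `ζⱼ = 0` on `closure V_M` for `j > M`. The patches
  `ψⱼ`, `‖ζⱼ f - ψⱼ‖_{W^{k,p}(Ω)} ≤ δⱼ`, are taken supported so close to `supp ζⱼ` that `ψⱼ = 0`
  on `closure V_M` for `j ≥ M + 2`. Then `φ = Σⱼ ψⱼ` is a locally finite sum of smooth
  functions, hence smooth on `Ω`; on `V_M`, `f - φ = Σ_{j ≤ M+1} (ζⱼ f - ψⱼ)`, so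
  `‖f - φ‖_{W^{k,p}(V_M)} ≤ Σⱼ δⱼ ≤ δ` by the triangle inequality, and `‖f - φ‖_{W^{k,p}(Ω)} ≤ δ`
  by Part B (`exists_contDiffOn_eSobolevDomainNorm_sub_le`). Taking `δ = 1/(n+1)` gives the
  sequence (`exists_contDiffOn_tendsto_eSobolevDomainNorm_sub`).

## The σ-algebra and the completeness of `F`

The named fact `meyers_serrin` binds neither `[BorelSpace E']` nor `[CompleteSpace F]`: both
are section variables of `SobolevTrace` which usage-based variable inclusion dropped from the
`def` (the sibling facts of `SobolevDomain`, e.g. `HasWeakFDerivOn.unique`,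
`rellich_kondrachov`, bind `∀ [BorelSpace E'] [CompleteSpace F]` explicitly).

* Completeness of `F` is not needed: for non-complete `F` Mathlib's Bochner integral is the
  junk value `0` (`MeasureTheory.integral_of_not_completeSpace`), every locally integrable
  function is a weak derivative of every other, `‖·‖_{W^{k,p}(Ω)} ≤ ‖·‖_{L^p(Ω)}`, and the
  statement reduces to Mathlib's density of `C_c^∞` in `L^p`, which is the accepted
  `SobolevApprox.exists_contDiff_tendsto_eSobolevDomainNorm_sub_of_not_completeSpace` of
  `SobolevTraceDensityHigherProofs` (any open `Ω`), used as is in the discharge.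
* The Borel σ-algebra, implicit in every source (Lebesgue measure on `ℝⁿ`), *is* needed, and
  `[BorelSpace E']` is an instance hypothesis of the discharge `meyers_serrin_holds`, which thus
  proves `meyers_serrin` at every Borel instance of `[MeasurableSpace E']` — the instances at
  which it is stated in `SobolevTrace` and used. It cannot be removed: `IsAddHaarMeasure` does
  not force the σ-algebra to be Borel, and Lebesgue measure on `ℝ` has translation-invariant
  extensions `μ` to σ-algebras `m` strictly larger than the Lebesgue σ-algebra for which the
  density theorem fails (K. Kodaira, S. Kakutani, Ann. of Math. (2) 52 (1950), 574–579;
  S. Kakutani, J. C. Oxtoby, ibid., 580–590; A. B. Kharazishvili, *Strange Functions in Real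
  Analysis*, 2nd ed. (2006), Ch. 6, Remark 5). Such a `μ` is an `IsAddHaarMeasure` on `(ℝ, m)`;
  in the Kodaira–Kakutani extension (the pull-back of `λ ⊗ η`, `η` the Haar measure of the
  circle, along `x ↦ (x, χ x)` for a discontinuous character `χ` with thick graph) the set
  `A = χ⁻¹(half circle) ∈ m` has `μ (A ∩ B) = λ B / 2` for every Borel `B`, so that
  `1_A ∈ W^{k,p}(Ω; μ)` for all `k` (all weak derivatives `0`:
  `∫_Ω ∂ᵥφ · 1_A dμ = ½ ∫_Ω ∂ᵥφ dλ = 0`), while `‖1_A - φ‖_{L¹(Ω; μ)} ≥ λ(Ω)/2` for every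
  continuous `φ`: at that (non-Borel) instance the literal Prop fails already for `k = 0`.

## Mathlib and tree search

Mathlib (this pin) has bump functions, convolution, smooth partitions of unity / smooth Urysohn
(`Geometry/Manifold/PartitionOfUnity`: `exists_contMDiffMap_zero_one_nhds_of_isClosed`),
density of `C_c^∞` in `L^p` (`MeasureTheory.MemLp.exist_eLpNorm_sub_le`), but no weak
derivatives, no `W^{k,p}(Ω)` and no Meyers–Serrin theorem (searched `Sobolev`, `Meyers`,
`mollif`, `HasWeakDeriv` in `Analysis/`, `MeasureTheory/`, `Geometry/`). In the tree, the
`W^{k,p}(Ω)` lemmas used here live in `SobolevTraceDensityProofs` (order `1`: `HasWeakFDerivOn`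
calculus, `memLp_continuous_smul`, `closedBall_subset_or_disjoint`, mollification) and
`SobolevTraceDensityHigherProofs` (all orders: `SobolevApprox.memSobolevDomain_of_succ`,
`eSobolevDomainNorm_succ_le`, `_zero_fun`, `_congr`, `_add_le`, `_sum_le`,
`contDiff_infty_fderiv_apply`, `tendsto_eSobolevDomainNorm_smul_sub_normed_convolution`,
`exists_smooth_tendsto_smul_of_tsupport_subset`,
`eSobolevDomainNorm_le_eLpNorm_of_not_completeSpace`,
`exists_contDiff_tendsto_eSobolevDomainNorm_sub_of_not_completeSpace`), and in
`SobolevDomainProofs` (`support_normed_convolution_subset`); they are imported, not restated.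

## References

* N. G. Meyers, J. Serrin, *H = W*, Proc. Nat. Acad. Sci. USA 51 (1964), 1055–1056 (the
  Theorem of the paper; the original is not held, the proof followed is its reproduction in
  Adams 1975).
* R. A. Adams, *Sobolev Spaces*, Pure and Applied Mathematics 65, Academic Press (1975):
  ¶1.57 (weak derivatives), Lemma 2.18 (mollifiers; Ch. II, "Mollifiers, approximation by
  smooth functions", pp. 29–31), and Ch. III, "Approximation by smooth functions on `Ω`",
  pp. 51–53: Theorem 3.14 (partitions of unity), Lemma 3.15 (`J_ε ∗ u → u` in `W^{m,p}(Ω')`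
  for `Ω' ⊂⊂ Ω`), Theorem 3.16 (Meyers and Serrin, `H^{m,p}(Ω) = W^{m,p}(Ω)` for
  `1 ≤ p < ∞`). In the second edition, R. A. Adams, J. J. F. Fournier (2003), the theorem is
  numbered 3.17 (as cited on `meyers_serrin`).
* K. Kodaira, S. Kakutani, *A non-separable translation invariant extension of the Lebesgue
  measure space*, Ann. of Math. (2) 52 (1950), 574–579; A. B. Kharazishvili, *Strange
  Functions in Real Analysis*, 2nd ed., Chapman & Hall/CRC (2006), Ch. 6, Remark 5 (only for
  the remark on the σ-algebra above).
* L. C. Evans, *Partial Differential Equations*, 2nd ed. (2010), §5.3.1, Theorem 1 (local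
  approximation), §5.3.2, Theorem 2 (global approximation by functions smooth in the domain),
  as cited on `meyers_serrin`.
-/

noncomputable section

open MeasureTheory TopologicalSpace Set Function Filter Metric Bornology
open scoped ENNReal NNReal Convolution ContDiff Topology Manifold

namespace Literature.Analysis.FunctionSpaces

namespace MeyersSerrin

open SobolevApprox

/-! ## Part A. More calculus of `W^{k,p}(Ω)` and of the Sobolev norm -/

section Calculus

variable {E' : Type*} [NormedAddCommGroup E'] [NormedSpace ℝ E'] [MeasurableSpace E']
variable {F : Type*} [NormedAddCommGroup F] [NormedSpace ℝ F]
variable {Ω : Opens E'} {μ : Measure E'} {p : ℝ≥0∞}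

/-- A weak derivative on `Ω` is unchanged by modifying `f` and `g` on `μ`-null subsets of `Ω`
(Evans, *PDE*, §5.2.1: weak derivatives are defined through integrals over `Ω`). [folklore] -/
theorem hasWeakFDerivOn_congr_ae {f f' : E' → F} {g g' : E' → E' →L[ℝ] F}
    (h : HasWeakFDerivOn Ω μ f g) (hf : f' =ᵐ[μ.restrict Ω] f) (hg : g' =ᵐ[μ.restrict Ω] g) :
    HasWeakFDerivOn Ω μ f' g' where
  locallyIntegrableOn := h.locallyIntegrableOn.congr hf.symm
  locallyIntegrableOn_deriv := h.locallyIntegrableOn_deriv.congr hg.symm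
  integral_fderiv_smul_eq φ v hφ := by
    have e1 : (fun x => (fderiv ℝ φ x v) • f' x) =ᵐ[μ.restrict Ω] fun x => (fderiv ℝ φ x v) • f x :=
      hf.mono fun x hx => by simp only [hx]
    have e2 : (fun x => φ x • g' x v) =ᵐ[μ.restrict Ω] fun x => φ x • g x v :=
      hg.mono fun x hx => by simp only [hx]
    rw [integral_congr_ae e1, integral_congr_ae e2]
    exact h.integral_fderiv_smul_eq φ v hφ

variable [FiniteDimensional ℝ E']

/-- The Sobolev norm on `Ω` only depends on the `μ|_Ω`-a.e. class of the function. [folklore] -/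
theorem eSobolevDomainNorm_congr_ae {k : ℕ} {f f' : E' → F} (h : f' =ᵐ[μ.restrict Ω] f) :
    eSobolevDomainNorm k p Ω μ f' = eSobolevDomainNorm k p Ω μ f := by
  cases k with
  | zero => exact eLpNorm_congr_ae h
  | succ k =>
    rw [eSobolevDomainNorm, eSobolevDomainNorm, eLpNorm_congr_ae h]
    congr 1
    refine iInf_congr fun g => iInf_congr_Prop ⟨fun hg => ?_, fun hg => ?_⟩ fun _ => rfl
    · exact hasWeakFDerivOn_congr_ae hg h.symm EventuallyEq.rfl
    · exact hasWeakFDerivOn_congr_ae hg h EventuallyEq.rfl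

/-- Monotonicity of the Sobolev norm in the domain: `‖f‖_{W^{k,p}(Ω')} ≤ ‖f‖_{W^{k,p}(Ω)}` for
`Ω' ⊆ Ω` (Adams–Fournier, *Sobolev Spaces*, §6.1: the restriction operator has norm `≤ 1`).
[folklore] -/
theorem eSobolevDomainNorm_mono_set {k : ℕ} :
    ∀ {Ω Ω' : Opens E'} {f : E' → F}, Ω' ≤ Ω →
      eSobolevDomainNorm k p Ω' μ f ≤ eSobolevDomainNorm k p Ω μ f := by
  induction k with
  | zero => intro Ω Ω' f h; exact eLpNorm_mono_measure f (Measure.restrict_mono_set μ h)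
  | succ k ih =>
    intro Ω Ω' f h
    rw [eSobolevDomainNorm, eSobolevDomainNorm]
    refine add_le_add (eLpNorm_mono_measure f (Measure.restrict_mono_set μ h))
      (le_iInf₂ fun g hg => (iInf₂_le g (HasWeakFDerivOn.mono_set_holds hg h)).trans ?_)
    exact Finset.sum_le_sum fun i _ => ih h

variable [BorelSpace E'] [CompleteSpace F]

/-- **The infimum in the Sobolev norm is attained at every weak derivative**: for any weak
derivative `g` of `f` on `Ω`, `‖f‖_{W^{k+1,p}(Ω)} = ‖f‖_{L^p(Ω)} + Σᵢ ‖g eᵢ‖_{W^{k,p}(Ω)}`, because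
weak derivatives are a.e. unique (`HasWeakFDerivOn.unique_holds`) and the norm only depends on
a.e. classes (Brezis, *Functional Analysis*, §9.1; Evans, *PDE*, §5.2.1). [folklore] -/
theorem eSobolevDomainNorm_succ_eq {k : ℕ} {f : E' → F} {g : E' → E' →L[ℝ] F}
    (hg : HasWeakFDerivOn Ω μ f g) :
    eSobolevDomainNorm (k + 1) p Ω μ f = eLpNorm f p (μ.restrict Ω) +
      ∑ i, eSobolevDomainNorm k p Ω μ (fun x => g x (Module.finBasis ℝ E' i)) := by
  rw [eSobolevDomainNorm]
  congr 1
  refine le_antisymm (iInf₂_le g hg) (le_iInf₂ fun g' hg' => le_of_eq ?_)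
  refine Finset.sum_congr rfl fun i _ => (eSobolevDomainNorm_congr_ae ?_).symm
  exact (HasWeakFDerivOn.unique_holds hg' hg).mono fun x hx => by simp [hx]

end Calculus

/-! ## Part B. Cut-offs, smooth functions on `Ω`, exhaustions, monotone convergence -/

section Cutoff

variable {E' : Type*} [NormedAddCommGroup E'] [NormedSpace ℝ E'] [FiniteDimensional ℝ E']

/-- **Smooth cut-off functions**: for a compact `K` inside an open `U` (finite-dimensional real
space) there is `χ ∈ C_c^∞(U)` with `χ = 1` on a neighbourhood of `K` (smooth Urysohn lemma;
Mathlib's `exists_contMDiffMap_zero_one_nhds_of_isClosed` applied to `(K_δ)ᶜ` and `K` for a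
`δ`-neighbourhood `K_δ ⊆ U` of `K`). [folklore] -/
theorem exists_smooth_cutoff {K U : Set E'} (hK : IsCompact K) (hU : IsOpen U) (hKU : K ⊆ U) :
    ∃ χ : E' → ℝ, ContDiff ℝ ∞ χ ∧ HasCompactSupport χ ∧ tsupport χ ⊆ U ∧
      ∀ᶠ x in 𝓝ˢ K, χ x = 1 := by
  obtain ⟨δ, hδ, hδU⟩ := hK.exists_cthickening_subset_open hU hKU
  have hd : Disjoint (thickening δ K)ᶜ K :=
    disjoint_compl_left.mono_right (self_subset_thickening hδ K)
  obtain ⟨f, hf0, hf1, -⟩ :=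
    exists_contMDiffMap_zero_one_nhds_of_isClosed (𝓘(ℝ, E')) (n := (⊤ : ℕ∞))
      isOpen_thickening.isClosed_compl hK.isClosed hd
  have hsupp : support (f : E' → ℝ) ⊆ thickening δ K := fun x hx => by
    by_contra hx'
    exact hx (hf0.self_of_nhdsSet x hx')
  have htsupp : tsupport (f : E' → ℝ) ⊆ cthickening δ K :=
    (closure_mono hsupp).trans (closure_thickening_subset_cthickening δ K)
  exact ⟨f, contMDiff_iff_contDiff.1 f.contMDiff,
    hK.cthickening.of_isClosed_subset (isClosed_tsupport _) htsupp, htsupp.trans hδU, hf1⟩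

variable [MeasurableSpace E'] [BorelSpace E'] {μ : Measure E'} [μ.IsAddHaarMeasure]
variable {F : Type*} [NormedAddCommGroup F] [NormedSpace ℝ F]

/-- **Functions smooth on `Ω` are weakly differentiable on `Ω`**, with weak derivative the
classical one (Evans, *PDE*, §5.2.1; Adams, *Sobolev Spaces* (1975), ¶1.57: a continuous
classical derivative on `Ω` is a distributional derivative on `Ω`). Reduced to the global `C¹`
case `HasWeakFDerivOn.of_contDiff_holds` by multiplying with a cut-off equal to `1` near the
support of the test function. [folklore] -/
theorem hasWeakFDerivOn_of_contDiffOn {Ω : Opens E'} {φ : E' → F} (hφ : ContDiffOn ℝ ∞ φ Ω) :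
    HasWeakFDerivOn Ω μ φ (fderiv ℝ φ) where
  locallyIntegrableOn := hφ.continuousOn.locallyIntegrableOn Ω.isOpen.measurableSet
  locallyIntegrableOn_deriv :=
    (hφ.continuousOn_fderiv_of_isOpen Ω.isOpen (by exact_mod_cast le_top)).locallyIntegrableOn
      Ω.isOpen.measurableSet
  integral_fderiv_smul_eq η v hη := by
    obtain ⟨χ, hχ, -, hχΩ, hχ1⟩ :=
      exists_smooth_cutoff hη.hasCompactSupport Ω.isOpen hη.tsupport_subset
    -- `Φ := χ • φ` is globally `C¹` and agrees with `φ` near `tsupport η`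
    set Φ : E' → F := fun x => χ x • φ x with hΦ_def
    have hΦ : ContDiff ℝ 1 Φ := by
      rw [contDiff_iff_contDiffAt]
      intro x
      by_cases hx : x ∈ (Ω : Set E')
      · exact ((hχ.of_le (by exact_mod_cast le_top)).contDiffAt).smul
          ((hφ.of_le (by exact_mod_cast le_top)).contDiffAt (Ω.isOpen.mem_nhds hx))
      · have hx' : x ∉ tsupport Φ := fun h => hx (hχΩ (tsupport_smul_subset_left χ φ h))
        exact contDiffAt_const.congr_of_eventuallyEq (notMem_tsupport_iff_eventuallyEq.1 hx')
    have hnhds : ∀ x ∈ tsupport η, Φ =ᶠ[𝓝 x] φ := fun x hx => by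
      filter_upwards [hχ1.filter_mono (nhds_le_nhdsSet hx)] with y hy
      rw [hΦ_def]
      simp only [hy, one_smul]
    have e1 : (fun x => (fderiv ℝ η x v) • Φ x) = fun x => (fderiv ℝ η x v) • φ x := by
      ext x
      by_cases hx : x ∈ tsupport η
      · rw [(hnhds x hx).self_of_nhds]
      · simp [fderiv_of_notMem_tsupport ℝ hx]
    have e2 : (fun x => η x • fderiv ℝ Φ x v) = fun x => η x • fderiv ℝ φ x v := by
      ext x
      by_cases hx : x ∈ tsupport η
      · rw [(hnhds x hx).fderiv_eq]
      · simp [image_eq_zero_of_notMem_tsupport hx]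
    have key := (HasWeakFDerivOn.of_contDiff_holds Ω μ hΦ).integral_fderiv_smul_eq η v hη
    rwa [e1, e2] at key

omit [FiniteDimensional ℝ E'] [MeasurableSpace E'] [BorelSpace E'] in
/-- The components `x ↦ Dφ x v` of the derivative of a function smooth on `Ω` are smooth on `Ω`.
[folklore] -/
theorem contDiffOn_fderiv_apply {Ω : Opens E'} {φ : E' → F} (hφ : ContDiffOn ℝ ∞ φ Ω) (v : E') :
    ContDiffOn ℝ ∞ (fun x => fderiv ℝ φ x v) Ω :=
  ((contDiffOn_infty_iff_fderiv_of_isOpen Ω.isOpen).1 hφ).2.clm_apply contDiffOn_const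

end Cutoff

section Exhaustion

variable {E' : Type*} [NormedAddCommGroup E'] [NormedSpace ℝ E'] [FiniteDimensional ℝ E']

/-- **Exhaustion of an open set by relatively compact open sets** (Adams, *Sobolev Spaces*
(1975), proof of Theorem 3.16: `Ω_k = {x ∈ Ω : |x| < k, dist(x, bdry Ω) > 1/k}`): open
`V₀ ⊆ V₁ ⊆ ⋯` with `closure Vₘ` compact and contained in `V_{m+1}`, exhausting `Ω`. Here
`Vₘ = B(0, m+1) ∩ {x | infEdist x Ωᶜ > 1/(m+1)}` (with `infEdist x ∅ = ∞`, so `Ω = E'` is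
allowed). [folklore] -/
theorem exists_exhaustion (Ω : Opens E') :
    ∃ V : ℕ → Opens E', Monotone V ∧ (∀ m, IsCompact (closure (V m : Set E'))) ∧
      (∀ m, closure (V m : Set E') ⊆ V (m + 1)) ∧ (∀ m, V m ≤ Ω) ∧
      (Ω : Set E') ⊆ ⋃ m, (V m : Set E') := by
  -- `d x = infEDist x Ωᶜ` (`= ∞` if `Ω = E'`), `r m = 1/(m+1)`, `R m = m + 1`
  let d : E' → ℝ≥0∞ := fun x => Metric.infEDist x ((Ω : Set E')ᶜ)
  let r : ℕ → ℝ≥0∞ := fun m => ((m + 1 : ℕ) : ℝ≥0∞)⁻¹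
  let R : ℕ → ℝ := fun m => ((m + 1 : ℕ) : ℝ)
  have hd : Continuous d := Metric.continuous_infEDist
  have hdpos : ∀ x, x ∈ (Ω : Set E') ↔ 0 < d x := fun x => by
    rw [Metric.infEDist_pos_iff_notMem_closure, Ω.isOpen.isClosed_compl.closure_eq,
      notMem_compl_iff]
  have hr : ∀ {m n : ℕ}, m ≤ n → r n ≤ r m := fun hmn =>
    ENNReal.inv_le_inv.2 (by exact_mod_cast Nat.succ_le_succ hmn)
  have hr' : ∀ m, r (m + 1) < r m := fun m =>
    ENNReal.inv_lt_inv.2 (by exact_mod_cast Nat.lt_succ_self _)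
  have hR : ∀ {m n : ℕ}, m ≤ n → R m ≤ R n := fun hmn => by
    simp only [R]; exact_mod_cast Nat.succ_le_succ hmn
  have hR' : ∀ m, R m < R (m + 1) := fun m => by
    simp only [R]; exact_mod_cast Nat.lt_succ_self _
  let V : ℕ → Opens E' := fun m =>
    ⟨{x | ‖x‖ < R m ∧ r m < d x},
      (isOpen_lt continuous_norm continuous_const).and (isOpen_lt continuous_const hd)⟩
  have hmem : ∀ m x, x ∈ (V m : Set E') ↔ ‖x‖ < R m ∧ r m < d x := fun m x => Iff.rfl
  have hVcl : ∀ m x, x ∈ closure (V m : Set E') → ‖x‖ ≤ R m ∧ r m ≤ d x := by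
    intro m x hx
    have h1 : closure (V m : Set E') ⊆ {x | ‖x‖ ≤ R m} :=
      (closure_mono fun y hy => ((hmem m y).1 hy).1).trans
        (closure_lt_subset_le continuous_norm continuous_const)
    have h2 : closure (V m : Set E') ⊆ {x | r m ≤ d x} :=
      (closure_mono fun y hy => ((hmem m y).1 hy).2).trans
        (closure_lt_subset_le continuous_const hd)
    exact ⟨h1 hx, h2 hx⟩
  refine ⟨V, fun m n hmn x hx => ?_, fun m => ?_, fun m x hx => ?_, fun m x hx => ?_,
    fun x hx => ?_⟩
  · -- monotone
    obtain ⟨hx1, hx2⟩ := (hmem m x).1 hx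
    exact (hmem n x).2 ⟨hx1.trans_le (hR hmn), (hr hmn).trans_lt hx2⟩
  · -- compact closure
    refine (isCompact_closedBall (0 : E') (R m)).of_isClosed_subset isClosed_closure fun x hx => ?_
    exact mem_closedBall_zero_iff.2 (hVcl m x hx).1
  · -- closure V m ⊆ V (m + 1)
    obtain ⟨hx1, hx2⟩ := hVcl m x hx
    exact (hmem (m + 1) x).2 ⟨hx1.trans_lt (hR' m), (hr' m).trans_le hx2⟩
  · -- V m ⊆ Ω
    exact (hdpos x).2 (lt_of_le_of_lt zero_le ((hmem m x).1 hx).2)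
  · -- cover
    have hx' : 0 < d x := (hdpos x).1 hx
    obtain ⟨n, hn⟩ := ENNReal.exists_inv_nat_lt hx'.ne'
    obtain ⟨n', hn'⟩ := exists_nat_gt ‖x‖
    refine mem_iUnion.2 ⟨max n n', (hmem _ x).2 ⟨hn'.trans_le ?_, lt_of_le_of_lt ?_ hn⟩⟩
    · simp only [R]; exact_mod_cast (le_max_right n n').trans (Nat.le_succ _)
    · exact ENNReal.inv_le_inv.2 (by exact_mod_cast (le_max_left n n').trans (Nat.le_succ _))

end Exhaustion

section MonotoneConvergence

variable {E' : Type*} [NormedAddCommGroup E'] [NormedSpace ℝ E'] [FiniteDimensional ℝ E']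
  [MeasurableSpace E'] [BorelSpace E'] {μ : Measure E'} [μ.IsAddHaarMeasure]
variable {F : Type*} [NormedAddCommGroup F] [NormedSpace ℝ F] [CompleteSpace F]
variable {p : ℝ≥0∞}

omit [FiniteDimensional ℝ E'] [BorelSpace E'] [μ.IsAddHaarMeasure] [CompleteSpace F]
  [NormedSpace ℝ E'] [NormedSpace ℝ F] in
/-- **Monotone convergence for `L^p` norms over an increasing union**: if `s ⊆ ⋃ₘ Vₘ` with
`V₀ ⊆ V₁ ⊆ ⋯ ⊆ s` measurable, then `‖h‖_{L^p(s)} ≤ supₘ ‖h‖_{L^p(Vₘ)}` (`0 < p < ∞`; Adams,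
*Sobolev Spaces* (1975), Theorem 1.43, as used at the end of the proof of Theorem 3.16).
[folklore] -/
theorem eLpNorm_restrict_le_iSup {X : Type*} [MeasurableSpace X] {ν : Measure X} {G : Type*}
    [NormedAddCommGroup G] {s : Set X} {V : ℕ → Set X} (hVm : ∀ m, MeasurableSet (V m))
    (hmono : Monotone V) (hVs : ∀ m, V m ⊆ s) (hsV : s ⊆ ⋃ m, V m) {h : X → G}
    (hh : AEStronglyMeasurable h (ν.restrict s)) (hp0 : p ≠ 0) (hp' : p ≠ ⊤) :
    eLpNorm h p (ν.restrict s) ≤ ⨆ m, eLpNorm h p (ν.restrict (V m)) := by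
  have hq : 0 < p.toReal := ENNReal.toReal_pos hp0 hp'
  simp only [eLpNorm_eq_lintegral_rpow_enorm_toReal hp0 hp']
  set Fh : X → ℝ≥0∞ := fun x => ‖h x‖ₑ ^ p.toReal with hFh_def
  have hFh : AEMeasurable Fh (ν.restrict s) := hh.enorm.pow_const _
  have hG : ∀ m, AEMeasurable ((V m).indicator Fh) ν := fun m =>
    (aemeasurable_indicator_iff (hVm m)).2
      (hFh.mono_measure (Measure.restrict_mono (hVs m) le_rfl))
  have hGmono : ∀ᵐ x ∂ν, Monotone fun m => (V m).indicator Fh x :=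
    Eventually.of_forall fun x m n hmn =>
      indicator_le_indicator_of_subset (hmono hmn) (fun _ => zero_le) x
  have key : ∫⁻ x in s, Fh x ∂ν ≤ ⨆ m, ∫⁻ x in V m, Fh x ∂ν :=
    calc ∫⁻ x in s, Fh x ∂ν ≤ ∫⁻ x in ⋃ m, V m, Fh x ∂ν := lintegral_mono_set hsV
      _ = ∫⁻ x, (⋃ m, V m).indicator Fh x ∂ν :=
          (lintegral_indicator (MeasurableSet.iUnion hVm) Fh).symm
      _ = ∫⁻ x, ⨆ m, (V m).indicator Fh x ∂ν := by
          congr 1 with x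
          exact indicator_iUnion_apply rfl V Fh x
      _ = ⨆ m, ∫⁻ x, (V m).indicator Fh x ∂ν := lintegral_iSup' hG hGmono
      _ = ⨆ m, ∫⁻ x in V m, Fh x ∂ν := iSup_congr fun m => lintegral_indicator (hVm m) Fh
  calc (∫⁻ x in s, Fh x ∂ν) ^ (1 / p.toReal)
      ≤ (⨆ m, ∫⁻ x in V m, Fh x ∂ν) ^ (1 / p.toReal) := ENNReal.rpow_le_rpow key (by positivity)
    _ = ⨆ m, (∫⁻ x in V m, Fh x ∂ν) ^ (1 / p.toReal) := by
        have := (ENNReal.orderIsoRpow (1 / p.toReal) (by positivity)).map_iSup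
          fun m => ∫⁻ x in V m, Fh x ∂ν
        simpa only [ENNReal.orderIsoRpow_apply] using this

/-- **Monotone convergence for the Sobolev norm along an exhaustion** (the step "by the
monotone convergence theorem 1.43, `‖u - φ‖_{m,p,Ω} ≤ ε`" closing the proof of Adams, *Sobolev
Spaces* (1975), Theorem 3.16, p. 53). For `f ∈ W^{k,p}(Ω)`, `φ ∈ C^∞(Ω)` and open
`V₀ ⊆ V₁ ⊆ ⋯` exhausting `Ω`: `‖f - φ‖_{W^{k,p}(Ω)} ≤ supₘ ‖f - φ‖_{W^{k,p}(Vₘ)}`. The proof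
uses that the infimum in `eSobolevDomainNorm` is attained at the explicit weak derivative
`Df - Dφ` on `Ω` and on every `Vₘ` (`eSobolevDomainNorm_succ_eq`), monotone convergence in
`L^p`, and induction on `k` over the components. [folklore] -/
theorem eSobolevDomainNorm_sub_le_iSup {Ω : Opens E'} (V : ℕ → Opens E') (hmono : Monotone V)
    (hVΩ : ∀ m, V m ≤ Ω) (hΩV : (Ω : Set E') ⊆ ⋃ m, (V m : Set E')) (hp0 : p ≠ 0)
    (hp' : p ≠ ⊤) {k : ℕ} :
    ∀ {f φ : E' → F}, MemSobolevDomain k p Ω μ f → ContDiffOn ℝ ∞ φ Ω →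
      eSobolevDomainNorm k p Ω μ (f - φ) ≤ ⨆ m, eSobolevDomainNorm k p (V m) μ (f - φ) := by
  have hbase : ∀ {h : E' → F}, AEStronglyMeasurable h (μ.restrict Ω) →
      eLpNorm h p (μ.restrict Ω) ≤ ⨆ m, eLpNorm h p (μ.restrict (V m)) := fun hh =>
    eLpNorm_restrict_le_iSup (fun m => (V m).isOpen.measurableSet) (fun m n hmn => hmono hmn)
      hVΩ hΩV hh hp0 hp'
  induction k with
  | zero =>
    intro f φ hf hφ
    simp only [eSobolevDomainNorm_zero]
    exact hbase (hf.aestronglyMeasurable.sub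
      (hφ.continuousOn.aestronglyMeasurable Ω.isOpen.measurableSet))
  | succ k ih =>
    intro f φ hf hφ
    obtain ⟨hf0, Df, hDf, hDfk⟩ := hf
    have hw : HasWeakFDerivOn Ω μ (f - φ) (Df - fderiv ℝ φ) :=
      hasWeakFDerivOn_sub hDf (hasWeakFDerivOn_of_contDiffOn hφ)
    have hcomp : ∀ i, (fun x => (Df - fderiv ℝ φ) x (Module.finBasis ℝ E' i)) =
        (fun x => Df x (Module.finBasis ℝ E' i)) - fun x => fderiv ℝ φ x (Module.finBasis ℝ E' i) :=
      fun i => by ext x; simp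
    have hm0 : Monotone fun m => eLpNorm (f - φ) p (μ.restrict (V m)) := fun m n hmn =>
      eLpNorm_mono_measure _ (Measure.restrict_mono_set μ (hmono hmn))
    have hm1 : ∀ i, Monotone fun m => eSobolevDomainNorm k p (V m) μ
        (fun x => (Df - fderiv ℝ φ) x (Module.finBasis ℝ E' i)) := fun i m n hmn =>
      eSobolevDomainNorm_mono_set (hmono hmn)
    rw [eSobolevDomainNorm_succ_eq hw]
    calc eLpNorm (f - φ) p (μ.restrict Ω) +
          ∑ i, eSobolevDomainNorm k p Ω μ (fun x => (Df - fderiv ℝ φ) x (Module.finBasis ℝ E' i))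
        ≤ (⨆ m, eLpNorm (f - φ) p (μ.restrict (V m))) +
          ∑ i, ⨆ m, eSobolevDomainNorm k p (V m) μ
            (fun x => (Df - fderiv ℝ φ) x (Module.finBasis ℝ E' i)) := by
          refine add_le_add (hbase hw.locallyIntegrableOn.aestronglyMeasurable)
            (Finset.sum_le_sum fun i _ => ?_)
          rw [hcomp i]
          exact ih (hDfk _) (contDiffOn_fderiv_apply hφ _)
      _ = ⨆ m, (eLpNorm (f - φ) p (μ.restrict (V m)) +
          ∑ i, eSobolevDomainNorm k p (V m) μ
            (fun x => (Df - fderiv ℝ φ) x (Module.finBasis ℝ E' i))) := by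
          rw [ENNReal.finsetSum_iSup_of_monotone hm1, ENNReal.iSup_add_iSup_of_monotone hm0]
          exact fun m n hmn => Finset.sum_le_sum fun i _ => hm1 i hmn
      _ = ⨆ m, eSobolevDomainNorm (k + 1) p (V m) μ (f - φ) :=
          iSup_congr fun m =>
            (eSobolevDomainNorm_succ_eq (HasWeakFDerivOn.mono_set_holds hw (hVΩ m))).symm

end MonotoneConvergence

/-! ## Part D. Proof of the Meyers–Serrin theorem -/

section Assembly

open ContinuousLinearMap

variable {E' : Type*} [NormedAddCommGroup E'] [NormedSpace ℝ E'] [FiniteDimensional ℝ E']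
  [MeasurableSpace E'] [BorelSpace E'] {μ : Measure E'} [μ.IsAddHaarMeasure]
variable {F : Type*} [NormedAddCommGroup F] [NormedSpace ℝ F] [CompleteSpace F]
variable {Ω : Opens E'} {p : ℝ≥0∞}

/-- **One patch of the Meyers–Serrin construction** (Adams, *Sobolev Spaces* (1975), proof of
Theorem 3.16, pp. 51–53: "we may choose `ε_k` ... such that
`‖J_{ε_k} ∗ (ψ_k u) - ψ_k u‖_{m,p,Ω} < ε/2^k`" with `J_{ε_k} ∗ (ψ_k u)` supported in a prescribed
neighbourhood of `supp ψ_k`; the convergence is Lemma 3.15). For `f ∈ W^{k,p}(Ω)`, a smooth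
cut-off `ζ` whose closed `d`-neighbourhood of its support lies in `Ω`, and `η > 0`, there is a
smooth `ψ` supported in the closed `d/2`-neighbourhood of `tsupport ζ` with
`‖ζ f - ψ‖_{W^{k,p}(Ω)} ≤ η`: a term of the mollified sequence of
`SobolevApprox.tendsto_eSobolevDomainNorm_smul_sub_normed_convolution` (centred kernels of
radii `d / (2(n+1))`, as in `SobolevApprox.exists_smooth_tendsto_smul_of_tsupport_subset`),
whose support is controlled by `support_normed_convolution_subset`.
[cite: Adams1975, Theorem 3.16 (proof), pp. 51–53] -/
theorem exists_smooth_patch_approx (hp : 1 ≤ p) (hp' : p ≠ ⊤) {k : ℕ} {f : E' → F}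
    (hf : MemSobolevDomain k p Ω μ f) {ζ : E' → ℝ} (hζ : ContDiff ℝ ∞ ζ)
    (hζc : HasCompactSupport ζ) {d : ℝ} (hd : 0 < d)
    (hdΩ : cthickening d (tsupport ζ) ⊆ (Ω : Set E')) {η : ℝ≥0∞} (hη : η ≠ 0) :
    ∃ ψ : E' → F, ContDiff ℝ ∞ ψ ∧ support ψ ⊆ cthickening (d / 2) (tsupport ζ) ∧
      eSobolevDomainNorm k p Ω μ ((fun x => ζ x • f x) - ψ) ≤ η := by
  -- radii `ε n = d / (2 (n + 1))`
  set ε : ℕ → ℝ := fun n => d / 2 * (1 / ((n : ℝ) + 1)) with hε_def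
  have hε : ∀ n, 0 < ε n := fun n => by positivity
  have hεd' : ∀ n, ε n ≤ d / 2 := fun n => by
    have h1 : 1 / ((n : ℝ) + 1) ≤ 1 := by
      rw [div_le_one (by positivity)]; linarith [n.cast_nonneg (α := ℝ)]
    calc ε n = d / 2 * (1 / ((n : ℝ) + 1)) := rfl
      _ ≤ d / 2 * 1 := by gcongr
      _ = d / 2 := mul_one _
  have hεd : ∀ n, 2 * ε n ≤ d := fun n => by linarith [hεd' n]
  have hεlim : Tendsto ε atTop (𝓝 0) := by
    have := tendsto_one_div_add_atTop_nhds_zero_nat.const_mul (d / 2)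
    rwa [mul_zero] at this
  let φ : ∀ n : ℕ, ContDiffBump ((fun _ : ℕ => (0 : E')) n) := fun n =>
    ⟨ε n / 2, ε n, half_pos (hε n), half_lt_self (hε n)⟩
  have hlim := tendsto_eSobolevDomainNorm_smul_sub_normed_convolution hp hp' hf hζ hζc φ
    tendsto_const_nhds hεlim fun n x _ => by
      simpa using closedBall_subset_or_disjoint hdΩ (hεd n) x
  obtain ⟨n, hn⟩ := ((ENNReal.tendsto_nhds_zero.1 hlim) η (pos_iff_ne_zero.2 hη)).exists
  -- the `n`-th mollification of the zero extension `𝟙_Ω ζ f`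
  have hGp : MemLp ((Ω : Set E').indicator fun x => ζ x • f x) p μ :=
    (memLp_indicator_iff_restrict Ω.isOpen.measurableSet).2
      (memLp_continuous_smul hζ.continuous hζc hf.memLp)
  have hGloc : LocallyIntegrable ((Ω : Set E').indicator fun x => ζ x • f x) μ :=
    hGp.locallyIntegrable hp
  refine ⟨(φ n).normed μ ⋆[lsmul ℝ ℝ, μ] (Ω : Set E').indicator (fun x => ζ x • f x),
    (φ n).hasCompactSupport_normed.contDiff_convolution_left _ (φ n).contDiff_normed hGloc,
    ?_, hn⟩
  have hGsupp : support ((Ω : Set E').indicator fun x => ζ x • f x) ⊆ tsupport ζ := by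
    rw [support_indicator]
    exact inter_subset_right.trans ((support_smul_subset_left ζ f).trans (subset_tsupport ζ))
  have hr : (φ n).rOut = ε n := rfl
  refine (support_normed_convolution_subset μ (φ n)).trans ?_
  rw [hr]
  exact (thickening_subset_cthickening (ε n) _).trans
    ((cthickening_subset_of_subset (ε n) hGsupp).trans (cthickening_mono (hεd' n) _))

/-- **Meyers–Serrin, quantitative core** (Adams, *Sobolev Spaces* (1975), Theorem 3.16,
pp. 51–53, numbered Theorem 3.17 in Adams–Fournier (2003); Meyers–Serrin, *H = W*, Proc. Nat.
Acad. Sci. USA 51 (1964); Evans, *PDE*, §5.3.2, Theorem 2). For `f ∈ W^{k,p}(Ω)` on an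
*arbitrary*
open `Ω`, `1 ≤ p < ∞`, and `δ > 0` there is `φ ∈ C^∞(Ω)` with `‖f - φ‖_{W^{k,p}(Ω)} ≤ δ`.
Proof as printed: exhaust `Ω` by `V₀ ⊂⊂ V₁ ⊂⊂ ⋯` (`exists_exhaustion`); cut-offs `χₘ = 1` near
`closure Vₘ` supported in `V_{m+1}` give the locally finite smooth partition of unity
`ζ₀ = χ₀`, `ζ_{m+1} = χ_{m+1} - χₘ` on `Ω` with `ζⱼ = 0` on `closure V_M` for `j > M`;
mollify each patch `ζⱼ f` within `δⱼ` in `W^{k,p}(Ω)` (`Σ δⱼ < δ`) keeping its support off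
`closure V_M` for `j ≥ M + 2` (`exists_smooth_patch_approx`); the locally finite sum
`φ = Σ ψⱼ` is smooth on `Ω`, on each `V_M` one has `f - φ = Σ_{j ≤ M+1} (ζⱼ f - ψⱼ)`, so
`‖f - φ‖_{W^{k,p}(V_M)} ≤ Σ δⱼ ≤ δ`, and `‖f - φ‖_{W^{k,p}(Ω)} ≤ δ` by monotone convergence
(`eSobolevDomainNorm_sub_le_iSup`). [cite: Adams1975, Theorem 3.16, pp. 51–53] -/
theorem exists_contDiffOn_eSobolevDomainNorm_sub_le (hp : 1 ≤ p) (hp' : p ≠ ⊤) {k : ℕ}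
    {f : E' → F} (hf : MemSobolevDomain k p Ω μ f) {δ : ℝ≥0∞} (hδ : δ ≠ 0) :
    ∃ φ : E' → F, ContDiffOn ℝ ∞ φ Ω ∧ eSobolevDomainNorm k p Ω μ (f - φ) ≤ δ := by
  have hp0 : p ≠ 0 := (zero_lt_one.trans_le hp).ne'
  -- `δ = Σ δ' j`
  obtain ⟨δ', hδ'pos, hδ'sum⟩ := ENNReal.exists_pos_sum_of_countable hδ ℕ
  -- exhaustion and cut-offs
  obtain ⟨V, hVmono, hVcpt, hVcl, hVΩ, hΩV⟩ := exists_exhaustion Ω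
  have hχex : ∀ m, ∃ χ : E' → ℝ, ContDiff ℝ ∞ χ ∧ HasCompactSupport χ ∧
      tsupport χ ⊆ (V (m + 1) : Set E') ∧ ∀ᶠ x in 𝓝ˢ (closure (V m : Set E')), χ x = 1 :=
    fun m => exists_smooth_cutoff (hVcpt m) (V (m + 1)).isOpen (hVcl m)
  choose χ hχs hχc hχV hχ1 using hχex
  have hχ1' : ∀ m, ∀ x ∈ closure (V m : Set E'), χ m x = 1 := fun m =>
    (hχ1 m).self_of_nhdsSet
  have hclmono : ∀ {m n}, m ≤ n → closure (V m : Set E') ⊆ closure (V n : Set E') :=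
    fun hmn => closure_mono (hVmono hmn)
  -- the telescoping partition of unity `ζ m = χ m - χ (m - 1)` (`χ (-1) = 0`)
  let χ' : ℕ → E' → ℝ := fun m => Nat.rec (0 : E' → ℝ) (fun j _ => χ j) m
  have hχ'0 : χ' 0 = 0 := rfl
  have hχ's : ∀ j, χ' (j + 1) = χ j := fun j => rfl
  let ζ : ℕ → E' → ℝ := fun m x => χ m x - χ' m x
  have hζs : ∀ m, ContDiff ℝ ∞ (ζ m) := by
    intro m
    cases m with
    | zero => exact (hχs 0).sub (by rw [hχ'0]; exact contDiff_const)
    | succ j => exact (hχs (j + 1)).sub (by rw [hχ's]; exact hχs j)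
  have hζc : ∀ m, HasCompactSupport (ζ m) := by
    intro m
    cases m with
    | zero => exact (hχc 0).sub (by rw [hχ'0]; exact HasCompactSupport.zero)
    | succ j => exact (hχc (j + 1)).sub (by rw [hχ's]; exact hχc j)
  have hζV : ∀ m, tsupport (ζ m) ⊆ (V (m + 1) : Set E') := by
    intro m
    refine (tsupport_sub (χ m) (χ' m)).trans (union_subset (hχV m) ?_)
    cases m with
    | zero => simp [hχ'0]
    | succ j => rw [hχ's]; exact (hχV j).trans (hVmono (Nat.le_succ _))
  have hζΩ : ∀ m, tsupport (ζ m) ⊆ (Ω : Set E') := fun m => (hζV m).trans (hVΩ (m + 1))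
  -- `ζ j = 0` on `closure (V M)` for `j > M`
  have hζ0 : ∀ {M j : ℕ}, M < j → ∀ x ∈ closure (V M : Set E'), ζ j x = 0 := by
    intro M j hMj x hx
    cases j with
    | zero => exact absurd hMj (Nat.not_lt_zero _)
    | succ j =>
      have hMj' : M ≤ j := Nat.lt_succ_iff.1 hMj
      show χ (j + 1) x - χ' (j + 1) x = 0
      rw [hχ's, hχ1' (j + 1) x (hclmono (hMj'.trans (Nat.le_succ j)) hx),
        hχ1' j x (hclmono hMj' hx), sub_self]
  -- telescoping: `Σ_{j ≤ M} ζ j = χ M`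
  have hζsum : ∀ M x, ∑ j ∈ Finset.range (M + 1), ζ j x = χ M x := by
    intro M x
    induction M with
    | zero => simp [ζ, hχ'0]
    | succ M ih =>
      rw [Finset.sum_range_succ, ih]
      show χ M x + (χ (M + 1) x - χ' (M + 1) x) = χ (M + 1) x
      rw [hχ's]; ring
  -- the open sets `O j = Ω ∖ ⋃_{M + 2 ≤ j} closure (V M)` carrying the mollified patches
  let O : ℕ → Set E' := fun j => (Ω : Set E') ∩ ⋂ (M : ℕ) (_ : M + 2 ≤ j), (closure (V M : Set E'))ᶜ
  have hO : ∀ j, IsOpen (O j) := fun j =>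
    Ω.isOpen.inter (((Set.finite_le_nat j).subset fun M (h : M + 2 ≤ j) =>
      show M ≤ j by omega).isOpen_biInter fun M _ => isClosed_closure.isOpen_compl)
  have hζO : ∀ j, tsupport (ζ j) ⊆ O j := by
    intro j
    refine subset_inter (hζΩ j) (subset_iInter₂ fun M hM => ?_)
    -- `ζ j = 0` on the open neighbourhood `V (M + 1)` of `closure (V M)`
    have h0 : ∀ x ∈ (V (M + 1) : Set E'), ζ j x = 0 := fun x hx =>
      hζ0 (by omega) x (subset_closure hx)
    have h1 : support (ζ j) ⊆ (V (M + 1) : Set E')ᶜ := fun x hx hx' => hx (h0 x hx')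
    have h2 : tsupport (ζ j) ⊆ (V (M + 1) : Set E')ᶜ :=
      closure_minimal h1 (V (M + 1)).isOpen.isClosed_compl
    exact h2.trans (compl_subset_compl.2 (hVcl M))
  have hdex : ∀ j, ∃ d : ℝ, 0 < d ∧ cthickening d (tsupport (ζ j)) ⊆ O j := fun j =>
    (hζc j).isCompact.exists_cthickening_subset_open (hO j) (hζO j)
  choose d hd hdO using hdex
  -- the mollified patches
  have hψex : ∀ j, ∃ ψ : E' → F, ContDiff ℝ ∞ ψ ∧
      support ψ ⊆ cthickening (d j / 2) (tsupport (ζ j)) ∧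
      eSobolevDomainNorm k p Ω μ ((fun x => ζ j x • f x) - ψ) ≤ δ' j := fun j =>
    exists_smooth_patch_approx hp hp' hf (hζs j) (hζc j) (hd j)
      ((hdO j).trans inter_subset_left) (ENNReal.coe_ne_zero.2 (hδ'pos j).ne')
  choose ψ hψs hψsupp hψδ using hψex
  -- `ψ j = 0` on `closure (V M)` for `j ≥ M + 2`
  have hψ0 : ∀ {M j : ℕ}, M + 2 ≤ j → ∀ x ∈ closure (V M : Set E'), ψ j x = 0 := by
    intro M j hMj x hx
    have hx' : x ∉ O j := fun h => (mem_iInter₂.1 h.2 M hMj) hx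
    exact notMem_support.1 fun h =>
      hx' (hdO j (cthickening_mono (by linarith [hd j]) _ (hψsupp j h)))
  -- the approximant: the locally finite sum `φ = Σ ψ j`
  let φ : E' → F := fun x => ∑' j, ψ j x
  have hφV : ∀ M, ∀ x ∈ closure (V M : Set E'),
      φ x = ∑ j ∈ Finset.range (M + 2), ψ j x := by
    intro M x hx
    refine tsum_eq_sum fun j hj => hψ0 ?_ x hx
    simpa using hj
  have hφsmooth : ContDiffOn ℝ ∞ φ Ω := by
    intro x hx
    obtain ⟨M, hM⟩ := mem_iUnion.1 (hΩV hx)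
    have heq : φ =ᶠ[𝓝 x] fun x => ∑ j ∈ Finset.range (M + 2), ψ j x :=
      eventuallyEq_of_mem ((V M).isOpen.mem_nhds hM) fun y hy => hφV M y (subset_closure hy)
    exact ((ContDiff.sum fun j _ => hψs j).contDiffAt.congr_of_eventuallyEq heq).contDiffWithinAt
  refine ⟨φ, hφsmooth, ?_⟩
  -- the estimate, first on each `V M`
  have hfm : ∀ M, AEStronglyMeasurable f (μ.restrict (V M)) := fun M =>
    hf.memLp.aestronglyMeasurable.mono_measure (Measure.restrict_mono_set μ (hVΩ M))
  have hVM : ∀ M, eSobolevDomainNorm k p (V M) μ (f - φ) ≤ δ := by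
    intro M
    have hEq : EqOn (f - φ) (∑ j ∈ Finset.range (M + 2), ((fun x => ζ j x • f x) - ψ j))
        (V M : Set E') := by
      intro x hx
      have hx' : x ∈ closure (V (M + 1) : Set E') := subset_closure (hVcl M (subset_closure hx))
      have h1 : ∑ j ∈ Finset.range (M + 2), ζ j x = 1 := by
        rw [hζsum (M + 1) x, hχ1' (M + 1) x hx']
      simp only [Pi.sub_apply, Finset.sum_apply, Finset.sum_sub_distrib, ← Finset.sum_smul, h1,
        one_smul, hφV M x (subset_closure hx)]
    calc eSobolevDomainNorm k p (V M) μ (f - φ)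
        = eSobolevDomainNorm k p (V M) μ
            (∑ j ∈ Finset.range (M + 2), ((fun x => ζ j x • f x) - ψ j)) :=
          eSobolevDomainNorm_congr hEq
      _ ≤ ∑ j ∈ Finset.range (M + 2), eSobolevDomainNorm k p (V M) μ
            ((fun x => ζ j x • f x) - ψ j) :=
          eSobolevDomainNorm_sum_le _ (fun j _ =>
            ((hζs j).continuous.aestronglyMeasurable.smul (hfm M)).sub
              (hψs j).continuous.aestronglyMeasurable) hp
      _ ≤ ∑ j ∈ Finset.range (M + 2), eSobolevDomainNorm k p Ω μ
            ((fun x => ζ j x • f x) - ψ j) :=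
          Finset.sum_le_sum fun j _ => eSobolevDomainNorm_mono_set (hVΩ M)
      _ ≤ ∑ j ∈ Finset.range (M + 2), (δ' j : ℝ≥0∞) := Finset.sum_le_sum fun j _ => hψδ j
      _ ≤ ∑' j, (δ' j : ℝ≥0∞) := ENNReal.sum_le_tsum _
      _ ≤ δ := hδ'sum.le
  exact (eSobolevDomainNorm_sub_le_iSup V hVmono hVΩ hΩV hp0 hp' hf hφsmooth).trans (iSup_le hVM)

/-- **Meyers–Serrin, sequential form, complete codomain**: for `f ∈ W^{k,p}(Ω)`, `1 ≤ p < ∞`,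
there are `φₙ ∈ C^∞(Ω)` with `‖f - φₙ‖_{W^{k,p}(Ω)} → 0` (take `δ = 1/(n+1)` in
`exists_contDiffOn_eSobolevDomainNorm_sub_le`) (Adams, *Sobolev Spaces* (1975),
Theorem 3.16). [cite: Adams1975, Theorem 3.16, pp. 51–53] -/
theorem exists_contDiffOn_tendsto_eSobolevDomainNorm_sub (hp : 1 ≤ p) (hp' : p ≠ ⊤) {k : ℕ}
    {f : E' → F} (hf : MemSobolevDomain k p Ω μ f) :
    ∃ φ : ℕ → E' → F, (∀ n, ContDiffOn ℝ ∞ (φ n) Ω) ∧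
      Tendsto (fun n => eSobolevDomainNorm k p Ω μ (f - φ n)) atTop (𝓝 0) := by
  have hδ : ∀ n : ℕ, ((n + 1 : ℕ) : ℝ≥0∞)⁻¹ ≠ 0 := fun n =>
    ENNReal.inv_ne_zero.2 (ENNReal.natCast_ne_top _)
  choose φ hφ hφδ using fun n => exists_contDiffOn_eSobolevDomainNorm_sub_le hp hp' hf (hδ n)
  refine ⟨φ, hφ, ?_⟩
  have hlim : Tendsto (fun n : ℕ => ((n + 1 : ℕ) : ℝ≥0∞)⁻¹) atTop (𝓝 0) :=
    ENNReal.tendsto_inv_nat_nhds_zero.comp (tendsto_add_atTop_nat 1)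
  exact tendsto_of_tendsto_of_tendsto_of_le_of_le tendsto_const_nhds hlim (fun n => bot_le) hφδ

end Assembly

end MeyersSerrin

/-! ## The discharge -/

section Final

variable {E' : Type*} [NormedAddCommGroup E'] [InnerProductSpace ℝ E'] [FiniteDimensional ℝ E']
  [MeasurableSpace E'] [BorelSpace E']
variable {F : Type*} [NormedAddCommGroup F] [NormedSpace ℝ F]

/-- **Discharge of `meyers_serrin` (Meyers–Serrin, `H = W`).** On an arbitrary open set `Ω` of
a finite-dimensional real inner product space with its Borel σ-algebra, for `1 ≤ p < ∞`, an
additive Haar measure `μ`, a real normed space `F` and `f ∈ W^{k,p}(Ω; F)`, there are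
functions `φₙ` smooth on `Ω` with `‖f - φₙ‖_{W^{k,p}(Ω)} → 0` (N. Meyers, J. Serrin, *H = W*,
Proc. Nat. Acad. Sci. USA 51 (1964), 1055–1056, Theorem; R. A. Adams, *Sobolev Spaces*
(1975), Theorem 3.16 "(Meyers and Serrin)", pp. 51–53, whose printed proof is formalised here;
numbered Theorem 3.17 in Adams–Fournier (2003); Evans, *PDE*, §5.3.2, Theorem 2). The named
fact binds neither `[BorelSpace E']` nor `[CompleteSpace F]` (see the module docstring): the
Borel σ-algebra, implicit in the sources, is an instance hypothesis of this discharge (at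
non-Borel instances the Prop can fail), so the theorem proves `meyers_serrin` at every Borel
instance; completeness of `F` is not assumed: for complete `F` this is
`MeyersSerrin.exists_contDiffOn_tendsto_eSobolevDomainNorm_sub`, otherwise all weak
derivatives are junk and the claim is density of `C_c^∞` in `L^p`
(`SobolevApprox.exists_contDiff_tendsto_eSobolevDomainNorm_sub_of_not_completeSpace`).
[cite: MeyersSerrin1964, Theorem] [cite: Adams1975, Theorem 3.16, pp. 51–53] -/
theorem meyers_serrin_holds : meyers_serrin (E' := E') (F := F) := by
  intro Ω k p hp hp' μ _ f hf
  by_cases hF : CompleteSpace F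
  · exact MeyersSerrin.exists_contDiffOn_tendsto_eSobolevDomainNorm_sub hp hp' hf
  · obtain ⟨φ, hφ, hlim⟩ :=
      SobolevApprox.exists_contDiff_tendsto_eSobolevDomainNorm_sub_of_not_completeSpace
        (Ω := Ω) hF hp hp' hf.memLp
    exact ⟨φ, fun n => (hφ n).contDiffOn, hlim⟩

end Final


end Literature.Analysis.FunctionSpaces
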